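import Mathlib
import Literature.MathematicalPhysics.QuantumFieldTheory.Luscher2010.TrivializingMaps
import Literature.MathematicalPhysics.QuantumFieldTheory.Luscher2010.FlowActionSeries
import Summits.Ventures.LatticeQCDFlow.TrivializingMaps.ConstantsCumulants
import Summits.Ventures.LatticeQCDFlow.TrivializingMaps.ZeroPinching
import HarnessLib

/-!
# THEOREM F on the lattice objects: the partition function generates Lüscher's flow constants —
`Z′(s) = Ċ^{[N]}(s) · Z(s) + s^{N+1} · J_N(s)` for every smooth Lüscher series and every `N`

HONEST FRAMING: exact (Metropolis-corrected) sampling algorithms for lattice gauge theory;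
figures of merit are autocorrelation/cost numbers at stated couplings and volumes; no
continuum-physics claim. This file is pure finite-dimensional calculus on the venture's own
objects and makes no physics claim.

Setting ([Luscher2010Trivializing] §2, §4): field manifold `SU(n)^E` inside the ambient
configurations `AmbConfig d L n` (`coeConfig`), Lüscher's trivial theory
`D[U] = trivialMeasure SU(n) d L` (product Haar, eq. (2.1)), link derivatives
`∂^a_e = linkDeriv e (T^a)`, link Laplacian `Δ = linkLap B` for an orthonormal basis `B = (T^a)` of
`𝔰𝔲(n)` (App. A), a SMOOTH action `S : AmbConfig d L n → ℝ` (e.g. `ambWilsonAction`) and a smooth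
LÜSCHER SERIES `(S^{(k)}, Ċ^{(k)})_k` of `S`, i.e. a solution of the recursion (4.12)–(4.15)
`Δ S^{(0)} = S + Ċ^{(0)}`, `Δ S^{(k+1)} = -∑_{e,a} ∂^a_e S · ∂^a_e S^{(k)} + Ċ^{(k+1)}` on `SU(n)^E`
(`IsLuscherSeries B S Sk c`). The complexified partition function of the flow `S_t = t S` is
WRITTEN OUT as Mathlib's complex moment generating function,
`Z(s) = ∫ D[U] e^{-s S(U)} = complexMGF (-S) D[U] s` (`s ∈ ℂ`).

Results (all `[ours]`, elementary):
* `linkDeriv_scalar_comp` (chain rule through a scalar function).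
* `integral_cexp_mul_linkLap` — **Green's identity with the complex Boltzmann weight**:
  `∫ D[U] e^{-sS} Δχ = -s ∑_{e,a} ∫ D[U] e^{-sS} ∂^a_e S ∂^a_e χ` (real Green identity
  `integral_mul_linkLap` of file `HaarByPartsZeroModes` applied to `Re e^{-sS}`, `Im e^{-sS}`).
* `IsLuscherSeries.integral_weight_linkLap_zero` / `_succ` (the recursion integrated against a
  continuous complex weight); `IsLuscherSeries.const_succ_eq_sum_integral`:
  `Ċ^{(k+1)} = ∑_{e,a} ⟨∂^a_e S ∂^a_e S^{(k)}⟩_{D[U]}` — like `Ċ^{(0)} = -⟨S⟩` (file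
  `ConstantsCumulants`, `IsLuscherSeries.const_zero_eq`) FORCED by solvability, for every action.
* **`IsLuscherSeries.deriv_complexMGF_eq`** (THEOREM F of THEORY-1 §13.1, finite form): for every
  `N` and every `s ∈ ℂ`, `Z′(s) = (∑_{k ≤ N} Ċ^{(k)} s^k) · Z(s) + s^{N+1} · J_N(s)` with
  `J_N(s) = ∑_{e,a} ∫ D[U] e^{-sS} ∂^a_e S · ∂^a_e S^{(N)}`. Read as formal power series at `s = 0`
  this is `∑_k Ċ^{(k)} s^k = Z′(s)/Z(s) = (log Z)′(s)` — the constants are the Haar cumulants of the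
  action, which file `ConstantsCumulants` (`IsLuscherSeries.const_moment_identity`) proves ORDER BY
  ORDER with real moments; the present EXACT identity at every complex `s`, with its remainder
  `J_N`, is what file `FisherRadiusCap` turns into the CAP of THEOREM F′: the constants' series of
  a geometrically bounded Lüscher series cannot converge past a complex (Fisher) zero of `Z`.
* `integrableExpSet_neg_action`, `differentiable_actionZ`, `deriv_actionZ_eq`: `Z` is entire,
  `Z′(s) = -∫ D[U] S e^{-sS}` (Mathlib's `hasDerivAt_complexMGF`; `S` is bounded on `SU(n)^E`).

References: M. Lüscher, Commun. Math. Phys. 293 (2010) 899–919, §4.2–§4.3 eqs. (4.6)–(4.15)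
[bib `Luscher2010Trivializing`]; THEORY-1.md §13.1 (THEOREM F), §23.
-/

open MeasureTheory ProbabilityTheory Filter Topology Complex Set Metric
open Literature.MathematicalPhysics.QuantumFieldTheory
open Literature.MathematicalPhysics.QuantumFieldTheory.Luscher2010
open Summit.Ventures.LatticeQCDFlow.TrivializingMaps.ZeroPinching
open Literature.MathematicalPhysics.QuantumFieldTheory.WilsonFlow (coeConfig continuous_coeConfig)
open scoped Matrix Matrix.Norms.Frobenius ContDiff

namespace Summit.Ventures.LatticeQCDFlow.TrivializingMaps

variable {d L n : ℕ}

section LinkCalculus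

variable [NeZero L]

/-- A smooth observable is continuous on the field manifold `SU(n)^E`. [folklore] -/
theorem continuous_comp_coeConfig {f : AmbConfig d L n → ℝ} (hf : ContDiff ℝ ∞ f) :
    Continuous fun U => f (coeConfig U) :=
  hf.continuous.comp continuous_coeConfig

/-- **Chain rule for the link derivative through a scalar function**:
`∂_{e,X} (g ∘ f)(W) = g′(f(W)) · ∂_{e,X} f(W)`. [folklore] -/
theorem linkDeriv_scalar_comp {g : ℝ → ℝ} {f : AmbConfig d L n → ℝ} {W : AmbConfig d L n}
    (hg : DifferentiableAt ℝ g (f W)) (hf : DifferentiableAt ℝ f W) (e : Edge d L)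
    (X : Matrix (Fin n) (Fin n) ℂ) :
    linkDeriv e X (fun W' => g (f W')) W = deriv g (f W) * linkDeriv e X f W := by
  have h1 := hasDerivAt_comp_linkCurve hf e X
  have h2 : HasDerivAt
      (fun s : ℝ => g (f (Function.update W e (NormedSpace.exp ((s : ℂ) • X) * W e))))
      (deriv g (f W) * fderiv ℝ f W (Pi.single e (X * W e))) 0 :=
    hg.hasDerivAt.comp_of_eq 0 h1 (by simp only [linkCurve_zero])
  show deriv (fun s : ℝ => g (f (Function.update W e (NormedSpace.exp ((s : ℂ) • X) * W e)))) 0 =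
    deriv g (f W) *
      deriv (fun s : ℝ => f (Function.update W e (NormedSpace.exp ((s : ℂ) • X) * W e))) 0
  rw [h2.deriv, h1.deriv]

/-- Continuous complex functions on the compact field manifold are `D[U]`-integrable. [folklore] -/
theorem integrable_trivialMeasure_of_continuous_complex
    {f : GaugeConfig d L (Matrix.specialUnitaryGroup (Fin n) ℂ) → ℂ} (hf : Continuous f) :
    Integrable f (trivialMeasure (Matrix.specialUnitaryGroup (Fin n) ℂ) d L) := by
  haveI : SecondCountableTopology (Matrix (Fin n) (Fin n) ℂ) :=
    inferInstanceAs (SecondCountableTopology (Fin n → Fin n → ℂ))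
  haveI : SecondCountableTopology (Matrix.specialUnitaryGroup (Fin n) ℂ) :=
    Topology.IsEmbedding.subtypeVal.secondCountableTopology
  exact (BoundedContinuousFunction.mkOfCompact ⟨f, hf⟩).integrable _

/-- Real part of the Bochner integral of an integrable complex function. [folklore] -/
theorem complex_re_integral_eq {α : Type*} [MeasurableSpace α] {μ : Measure α} {φ : α → ℂ}
    (hφ : Integrable φ μ) : (∫ x, φ x ∂μ).re = ∫ x, (φ x).re ∂μ := by
  simpa using (Complex.reCLM.integral_comp_comm hφ).symm

/-- Imaginary part of the Bochner integral of an integrable complex function. [folklore] -/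
theorem complex_im_integral_eq {α : Type*} [MeasurableSpace α] {μ : Measure α} {φ : α → ℂ}
    (hφ : Integrable φ μ) : (∫ x, φ x ∂μ).im = ∫ x, (φ x).im ∂μ := by
  simpa using (Complex.imCLM.integral_comp_comm hφ).symm

/-- The complex Boltzmann weight `W ↦ e^{-s S(W)}` is smooth for smooth `S`. [folklore] -/
theorem contDiff_cexp_neg_mul {S : AmbConfig d L n → ℝ} (hS : ContDiff ℝ ∞ S) (s : ℂ) :
    ContDiff ℝ ∞ fun W : AmbConfig d L n => cexp (-(s * (S W : ℂ))) :=
  (contDiff_const.mul (Complex.ofRealCLM.contDiff.comp hS)).neg.cexp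

/-- `d/dy e^{-s y} = -s e^{-s y}` along the real axis. [folklore] -/
theorem hasDerivAt_cexp_neg_mul_ofReal (s : ℂ) (x : ℝ) :
    HasDerivAt (fun y : ℝ => cexp (-(s * (y : ℂ)))) (-s * cexp (-(s * (x : ℂ)))) x :=
  ((((hasDerivAt_id' x).ofReal_comp).const_mul s).fun_neg.cexp).congr_deriv (by push_cast; ring)

/-- A smooth function of the links is bounded on the compact field manifold. [folklore] -/
theorem exists_abs_le_of_contDiff {S : AmbConfig d L n → ℝ} (hS : ContDiff ℝ ∞ S) :
    ∃ b : ℝ, ∀ U, |S (coeConfig U)| ≤ b := by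
  obtain ⟨b, hb⟩ := (isCompact_range (continuous_comp_coeConfig hS).norm).bddAbove
  exact ⟨b, fun U => by simpa [Real.norm_eq_abs] using hb ⟨U, rfl⟩⟩

end LinkCalculus

section PartitionFunction

variable [NeZero L] {S : AmbConfig d L n → ℝ}

/-- `-S` has all exponential moments under `D[U]`: `integrableExpSet (-S) D[U] = ℝ`. [folklore] -/
theorem integrableExpSet_neg_action (hS : ContDiff ℝ ∞ S) :
    integrableExpSet (fun U => -S (coeConfig U))
      (trivialMeasure (Matrix.specialUnitaryGroup (Fin n) ℂ) d L) = univ := by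
  obtain ⟨b, hb⟩ := exists_abs_le_of_contDiff hS
  exact integrableExpSet_eq_univ_of_abs_le (integrable_trivialMeasure_of_continuous
    (continuous_comp_coeConfig hS).neg).aemeasurable (ae_of_all _ fun U => by simpa using hb U)

/-- `Z(s) = ∫ D[U] e^{-sS}`: unfolding the complex MGF of `-S`. [folklore] -/
theorem complexMGF_neg_action_eq (s : ℂ) :
    complexMGF (fun U => -S (coeConfig U))
        (trivialMeasure (Matrix.specialUnitaryGroup (Fin n) ℂ) d L) s =
      ∫ U, cexp (-(s * (S (coeConfig U) : ℂ)))
        ∂(trivialMeasure (Matrix.specialUnitaryGroup (Fin n) ℂ) d L) := by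
  simp only [complexMGF, Complex.ofReal_neg, mul_neg]

/-- **`Z` is entire.** [folklore] -/
theorem differentiable_actionZ (hS : ContDiff ℝ ∞ S) :
    Differentiable ℂ (complexMGF (fun U => -S (coeConfig U))
      (trivialMeasure (Matrix.specialUnitaryGroup (Fin n) ℂ) d L)) := by
  obtain ⟨b, hb⟩ := exists_abs_le_of_contDiff hS
  exact differentiable_complexMGF_of_abs_le (integrable_trivialMeasure_of_continuous
    (continuous_comp_coeConfig hS).neg).aemeasurable (ae_of_all _ fun U => by simpa using hb U)

/-- **`Z′(s) = -∫ D[U] S e^{-sS}`** (Mathlib's `hasDerivAt_complexMGF`). [folklore] -/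
theorem deriv_actionZ_eq (hS : ContDiff ℝ ∞ S) (s : ℂ) :
    deriv (complexMGF (fun U => -S (coeConfig U))
        (trivialMeasure (Matrix.specialUnitaryGroup (Fin n) ℂ) d L)) s =
      -∫ U, cexp (-(s * (S (coeConfig U) : ℂ))) * (S (coeConfig U) : ℂ)
        ∂(trivialMeasure (Matrix.specialUnitaryGroup (Fin n) ℂ) d L) := by
  have hz : s.re ∈ interior (integrableExpSet (fun U => -S (coeConfig U))
      (trivialMeasure (Matrix.specialUnitaryGroup (Fin n) ℂ) d L)) := by
    rw [integrableExpSet_neg_action hS, interior_univ]; exact mem_univ _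
  rw [(hasDerivAt_complexMGF hz).deriv, ← integral_neg]
  refine integral_congr_ae (ae_of_all _ fun U => ?_)
  simp only [Complex.ofReal_neg, mul_neg, neg_mul]
  ring

end PartitionFunction

section ComplexGreen

variable [NeZero L]

/-- **Green's identity with a complex Boltzmann weight**: for smooth real `S, χ` and `s ∈ ℂ`,
`∫ D[U] e^{-sS} Δχ = -s ∑_{e,a} ∫ D[U] e^{-sS} ∂^a_e S ∂^a_e χ` (real Green identity
`integral_mul_linkLap` for `Re e^{-sS}`, `Im e^{-sS}` + chain rule `∂ e^{-sS} = -s e^{-sS} ∂S`).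
[cite: Luscher2010Trivializing, §4.2 eq. (4.8)] -/
theorem integral_cexp_mul_linkLap (B : SuBasis n) {S χ : AmbConfig d L n → ℝ}
    (hS : ContDiff ℝ ∞ S) (hχ : ContDiff ℝ ∞ χ) (s : ℂ) :
    ∫ U, cexp (-(s * (S (coeConfig U) : ℂ))) * (linkLap B χ (coeConfig U) : ℂ)
        ∂(trivialMeasure (Matrix.specialUnitaryGroup (Fin n) ℂ) d L) =
      -s * ∑ e : Edge d L, ∑ a : B.ι, ∫ U, cexp (-(s * (S (coeConfig U) : ℂ))) *
        ((linkDeriv e (B.T a) S (coeConfig U) * linkDeriv e (B.T a) χ (coeConfig U) : ℝ) : ℂ)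
          ∂(trivialMeasure (Matrix.specialUnitaryGroup (Fin n) ℂ) d L) := by
  have hwc : Continuous fun U => cexp (-(s * (S (coeConfig U) : ℂ))) :=
    (contDiff_cexp_neg_mul hS s).continuous.comp continuous_coeConfig
  -- real and imaginary parts of the scalar weight `y ↦ e^{-sy}` and their derivatives
  obtain ⟨gr, hgr⟩ : ∃ gr : ℝ → ℝ, gr = fun y : ℝ => (cexp (-(s * (y : ℂ)))).re := ⟨_, rfl⟩
  obtain ⟨gi, hgi⟩ : ∃ gi : ℝ → ℝ, gi = fun y : ℝ => (cexp (-(s * (y : ℂ)))).im := ⟨_, rfl⟩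
  have hdr : ∀ y : ℝ, HasDerivAt gr ((-s * cexp (-(s * (y : ℂ)))).re) y := fun y => by
    have h := Complex.reCLM.hasFDerivAt.comp_hasDerivAt y (hasDerivAt_cexp_neg_mul_ofReal s y)
    rw [hgr]
    exact h
  have hdi : ∀ y : ℝ, HasDerivAt gi ((-s * cexp (-(s * (y : ℂ)))).im) y := fun y => by
    have h := Complex.imCLM.hasFDerivAt.comp_hasDerivAt y (hasDerivAt_cexp_neg_mul_ofReal s y)
    rw [hgi]
    exact h
  have hu : ContDiff ℝ ∞ fun W => gr (S W) := by
    rw [hgr]; exact Complex.reCLM.contDiff.comp (contDiff_cexp_neg_mul hS s)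
  have hv : ContDiff ℝ ∞ fun W => gi (S W) := by
    rw [hgi]; exact Complex.imCLM.contDiff.comp (contDiff_cexp_neg_mul hS s)
  have hdu : ∀ (e : Edge d L) (X : Matrix (Fin n) (Fin n) ℂ) (W : AmbConfig d L n),
      linkDeriv e X (fun W' => gr (S W')) W =
        (-s * cexp (-(s * (S W : ℂ)))).re * linkDeriv e X S W := fun e X W => by
    rw [linkDeriv_scalar_comp (hdr (S W)).differentiableAt (hS.differentiable (by simp) W) e X,
      (hdr (S W)).deriv]
  have hdv : ∀ (e : Edge d L) (X : Matrix (Fin n) (Fin n) ℂ) (W : AmbConfig d L n),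
      linkDeriv e X (fun W' => gi (S W')) W =
        (-s * cexp (-(s * (S W : ℂ)))).im * linkDeriv e X S W := fun e X W => by
    rw [linkDeriv_scalar_comp (hdi (S W)).differentiableAt (hS.differentiable (by simp) W) e X,
      (hdi (S W)).deriv]
  have hGr := integral_mul_linkLap B hu hχ
  have hGi := integral_mul_linkLap B hv hχ
  simp_rw [hdu] at hGr
  simp_rw [hdv] at hGi
  have hi1 : Integrable (fun U => cexp (-(s * (S (coeConfig U) : ℂ))) * (linkLap B χ
      (coeConfig U) : ℂ)) (trivialMeasure (Matrix.specialUnitaryGroup (Fin n) ℂ) d L) :=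
    integrable_trivialMeasure_of_continuous_complex
      (hwc.mul (Complex.continuous_ofReal.comp (continuous_comp_coeConfig (contDiff_linkLap B hχ))))
  have hi2 : ∀ (e : Edge d L) (a : B.ι), Integrable (fun U =>
      -s * cexp (-(s * (S (coeConfig U) : ℂ))) *
        ((linkDeriv e (B.T a) S (coeConfig U) * linkDeriv e (B.T a) χ (coeConfig U) : ℝ) : ℂ))
          (trivialMeasure (Matrix.specialUnitaryGroup (Fin n) ℂ) d L) := fun e a =>
    integrable_trivialMeasure_of_continuous_complex ((continuous_const.mul hwc).mul
      (Complex.continuous_ofReal.comp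
        ((continuous_comp_coeConfig (contDiff_linkDeriv hS e (B.T a))).mul
          (continuous_comp_coeConfig (contDiff_linkDeriv hχ e (B.T a))))))
  rw [Finset.mul_sum]
  simp_rw [Finset.mul_sum, ← integral_const_mul, ← mul_assoc]
  apply Complex.ext
  · rw [complex_re_integral_eq hi1, Complex.re_sum]
    simp_rw [Complex.re_sum, complex_re_integral_eq (hi2 _ _), Complex.re_mul_ofReal]
    simpa only [hgr, mul_assoc] using hGr
  · rw [complex_im_integral_eq hi1, Complex.im_sum]
    simp_rw [Complex.im_sum, complex_im_integral_eq (hi2 _ _), Complex.im_mul_ofReal]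
    simpa only [hgi, mul_assoc] using hGi

end ComplexGreen

section Recursion

variable [NeZero L] {B : SuBasis n} {S : AmbConfig d L n → ℝ} {Sk : ℕ → AmbConfig d L n → ℝ}
  {c : ℕ → ℝ}

/-- Order `0` of the recursion paired with a continuous weight `w`:
`∫ w ΔS^{(0)} = ∫ w S + Ċ^{(0)} ∫ w`. [cite: Luscher2010Trivializing, §4.3 eq. (4.12)] -/
theorem IsLuscherSeries.integral_weight_linkLap_zero (h : IsLuscherSeries B S Sk c)
    (hS : ContDiff ℝ ∞ S) {w : GaugeConfig d L (Matrix.specialUnitaryGroup (Fin n) ℂ) → ℂ}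
    (hw : Continuous w) :
    ∫ U, w U * (linkLap B (Sk 0) (coeConfig U) : ℂ)
        ∂(trivialMeasure (Matrix.specialUnitaryGroup (Fin n) ℂ) d L) =
      ∫ U, w U * (S (coeConfig U) : ℂ) ∂(trivialMeasure (Matrix.specialUnitaryGroup (Fin n) ℂ) d L)
        + c 0 * ∫ U, w U ∂(trivialMeasure (Matrix.specialUnitaryGroup (Fin n) ℂ) d L) := by
  have hpt : ∀ U,
      w U * (linkLap B (Sk 0) (coeConfig U) : ℂ) =
        w U * (S (coeConfig U) : ℂ) + c 0 * w U := fun U => by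
    rw [h.1 U]; push_cast; ring
  simp_rw [hpt]
  rw [integral_add, integral_const_mul]
  · exact integrable_trivialMeasure_of_continuous_complex
      (hw.mul (Complex.continuous_ofReal.comp (continuous_comp_coeConfig hS)))
  · exact integrable_trivialMeasure_of_continuous_complex (continuous_const.mul hw)

/-- Order `k + 1` paired with a continuous weight `w`: `∫ w ΔS^{(k+1)} =
-∑_{e,a} ∫ w ∂^a_e S ∂^a_e S^{(k)} + Ċ^{(k+1)} ∫ w`. [cite: Luscher2010Trivializing, eq. (4.13)] -/
theorem IsLuscherSeries.integral_weight_linkLap_succ (h : IsLuscherSeries B S Sk c)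
    (hS : ContDiff ℝ ∞ S) (hSk : ∀ k, ContDiff ℝ ∞ (Sk k))
    {w : GaugeConfig d L (Matrix.specialUnitaryGroup (Fin n) ℂ) → ℂ} (hw : Continuous w) (k : ℕ) :
    ∫ U, w U * (linkLap B (Sk (k + 1)) (coeConfig U) : ℂ)
        ∂(trivialMeasure (Matrix.specialUnitaryGroup (Fin n) ℂ) d L) =
      -(∑ e : Edge d L, ∑ a : B.ι, ∫ U, w U *
          ((linkDeriv e (B.T a) S (coeConfig U) * linkDeriv e (B.T a) (Sk k) (coeConfig U) : ℝ) : ℂ)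
              ∂(trivialMeasure (Matrix.specialUnitaryGroup (Fin n) ℂ) d L)) +
        c (k + 1) * ∫ U, w U ∂(trivialMeasure (Matrix.specialUnitaryGroup (Fin n) ℂ) d L) := by
  have hpt : ∀ U,
      w U * (linkLap B (Sk (k + 1)) (coeConfig U) : ℂ) =
        -(∑ e : Edge d L, ∑ a : B.ι, w U *
          ((linkDeriv e (B.T a) S (coeConfig U) *
            linkDeriv e (B.T a) (Sk k) (coeConfig U) : ℝ) : ℂ)) + c (k + 1) * w U :=
    fun U => by
      rw [h.2 k U]; push_cast
      rw [mul_add, mul_neg, Finset.mul_sum]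
      simp_rw [Finset.mul_sum]
      ring
  have hi : ∀ (e : Edge d L) (a : B.ι), Integrable (fun U => w U *
      ((linkDeriv e (B.T a) S (coeConfig U) * linkDeriv e (B.T a) (Sk k) (coeConfig U) : ℝ) : ℂ))
          (trivialMeasure (Matrix.specialUnitaryGroup (Fin n) ℂ) d L) := fun e a =>
    integrable_trivialMeasure_of_continuous_complex (hw.mul (Complex.continuous_ofReal.comp
      ((continuous_comp_coeConfig (contDiff_linkDeriv hS e (B.T a))).mul
        (continuous_comp_coeConfig (contDiff_linkDeriv (hSk k) e (B.T a))))))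
  simp_rw [hpt]
  rw [integral_add, integral_neg, integral_const_mul, integral_finsetSum _ fun e _ =>
    integrable_finsetSum _ fun a _ => hi e a]
  · simp_rw [integral_finsetSum _ fun a _ => hi _ a]
  · exact (integrable_finsetSum _ fun e _ => integrable_finsetSum _ fun a _ => hi e a).neg
  · exact integrable_trivialMeasure_of_continuous_complex (continuous_const.mul hw)

/-- **`Ċ^{(k+1)} = ∑_{e,a} ⟨∂^a_e S · ∂^a_e S^{(k)}⟩_{D[U]}`**: like `Ċ^{(0)} = -⟨S⟩`
(`IsLuscherSeries.const_zero_eq`, file `ConstantsCumulants`), the higher constants are FORCED by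
solvability (pair the recursion with `1`: `∫ D[U] Δχ = 0`), for every smooth action and series.
[cite: Luscher2010Trivializing, §4.3 eq. (4.15)] -/
theorem IsLuscherSeries.const_succ_eq_sum_integral (h : IsLuscherSeries B S Sk c)
    (hS : ContDiff ℝ ∞ S) (hSk : ∀ k, ContDiff ℝ ∞ (Sk k)) (k : ℕ) :
    c (k + 1) = ∑ e : Edge d L, ∑ a : B.ι, ∫ U, linkDeriv e (B.T a) S (coeConfig U) *
      linkDeriv e (B.T a) (Sk k) (coeConfig U)
        ∂(trivialMeasure (Matrix.specialUnitaryGroup (Fin n) ℂ) d L) := by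
  have h1 := IsLuscherSeries.integral_weight_linkLap_succ h hS hSk (w := fun _ => (1 : ℂ))
    continuous_const k
  simp only [one_mul, integral_const, probReal_univ, one_smul, mul_one,
    integral_complex_ofReal, integral_linkLap_eq_zero B (hSk (k + 1)), Complex.ofReal_zero] at h1
  have h2 : ((c (k + 1) : ℝ) : ℂ) = ((∑ e : Edge d L, ∑ a : B.ι, ∫ U,
      linkDeriv e (B.T a) S (coeConfig U) *
        linkDeriv e (B.T a) (Sk k) (coeConfig U)
          ∂(trivialMeasure (Matrix.specialUnitaryGroup (Fin n) ℂ) d L) : ℝ) : ℂ) := by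
    push_cast at h1 ⊢
    linear_combination -h1
  exact_mod_cast h2

end Recursion

section TheoremF

variable [NeZero L] {B : SuBasis n} {S : AmbConfig d L n → ℝ} {Sk : ℕ → AmbConfig d L n → ℝ}
  {c : ℕ → ℝ}

/-- **THEOREM F (Lüscher's flow constants are generated by the partition function).** For a
smooth action `S` on `SU(n)^E`, a smooth Lüscher series `(S^{(k)}, Ċ^{(k)})` of `S`, every `N`
and every `s ∈ ℂ`: `Z′(s) = (∑_{k=0}^{N} Ċ^{(k)} s^k) · Z(s) + s^{N+1} · J_N(s)`,
`J_N(s) = ∑_{e,a} ∫ D[U] e^{-sS} ∂^a_e S ∂^a_e S^{(N)}`, `Z(s) = ∫ D[U] e^{-sS}`. Proof: pair the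
recursion with `e^{-sS}`; by the complex-weight Green identity the relations telescope.
[cite: Luscher2010Trivializing, §4.2–§4.3 eqs. (4.8)–(4.15)] -/
theorem IsLuscherSeries.deriv_complexMGF_eq (h : IsLuscherSeries B S Sk c) (hS : ContDiff ℝ ∞ S)
    (hSk : ∀ k, ContDiff ℝ ∞ (Sk k)) (N : ℕ) (s : ℂ) :
    deriv (complexMGF (fun U => -S (coeConfig U))
        (trivialMeasure (Matrix.specialUnitaryGroup (Fin n) ℂ) d L)) s =
      (∑ k ∈ Finset.range (N + 1), (c k : ℂ) * s ^ k) *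
          complexMGF (fun U => -S (coeConfig U))
            (trivialMeasure (Matrix.specialUnitaryGroup (Fin n) ℂ) d L) s +
        s ^ (N + 1) * ∑ e : Edge d L, ∑ a : B.ι,
          ∫ U, cexp (-(s * (S (coeConfig U) : ℂ))) *
            ((linkDeriv e (B.T a) S (coeConfig U) *
              linkDeriv e (B.T a) (Sk N) (coeConfig U) : ℝ) : ℂ)
                ∂(trivialMeasure (Matrix.specialUnitaryGroup (Fin n) ℂ) d L) := by
  -- name the pairings `J k = ∑_{e,a} ∫ e^{-sS} ∂S ∂S^{(k)}`
  obtain ⟨J, hJ⟩ : ∃ J : ℕ → ℂ, ∀ k, J k = ∑ e : Edge d L, ∑ a : B.ι,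
      ∫ U, cexp (-(s * (S (coeConfig U) : ℂ))) *
        ((linkDeriv e (B.T a) S (coeConfig U) * linkDeriv e (B.T a) (Sk k) (coeConfig U) : ℝ) : ℂ)
            ∂(trivialMeasure (Matrix.specialUnitaryGroup (Fin n) ℂ) d L) := ⟨_, fun _ => rfl⟩
  have hwc : Continuous fun U => cexp (-(s * (S (coeConfig U) : ℂ))) :=
    (contDiff_cexp_neg_mul hS s).continuous.comp continuous_coeConfig
  -- Green: `∫ e^{-sS} ΔS^{(k)} = -s J k`
  have hG : ∀ k, ∫ U, cexp (-(s * (S (coeConfig U) : ℂ))) *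
      (linkLap B (Sk k) (coeConfig U) : ℂ)
        ∂(trivialMeasure (Matrix.specialUnitaryGroup (Fin n) ℂ) d L) = -s * J k :=
    fun k => by rw [hJ k]; exact integral_cexp_mul_linkLap B hS (hSk k) s
  have h0 := IsLuscherSeries.integral_weight_linkLap_zero h hS hwc
  have hk := fun k => IsLuscherSeries.integral_weight_linkLap_succ h hS hSk hwc k
  rw [hG, ← complexMGF_neg_action_eq] at h0
  have hstep : ∀ k, J k = c (k + 1) *
      complexMGF (fun U => -S (coeConfig U))
        (trivialMeasure (Matrix.specialUnitaryGroup (Fin n) ℂ) d L) s + s * J (k + 1) := fun k => by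
    have := hk k
    rw [hG, ← hJ k, ← complexMGF_neg_action_eq] at this
    linear_combination this
  rw [← hJ N, deriv_actionZ_eq hS s]
  induction N with
  | zero =>
      simp only [zero_add, Finset.sum_range_one, pow_zero, mul_one, pow_one]
      linear_combination h0
  | succ N ih =>
      rw [Finset.sum_range_succ, ih, hstep N]
      ring

end TheoremF

end Summit.Ventures.LatticeQCDFlow.TrivializingMaps
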